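import Mathlib.LinearAlgebra.Matrix.SpecialLinearGroup
import Mathlib.LinearAlgebra.Matrix.Determinant.Basic
import Mathlib.RingTheory.MvPolynomial.Homogeneous
import Literature.Computability.AlgebraicComplexity.LinSubst
import Literature.Computability.AlgebraicComplexity.LinSubstProofs
import Literature.Computability.AlgebraicComplexity.StandardFamilies
import Literature.Computability.AlgebraicComplexity.DeterminantalComplexity
import Literature.Computability.AlgebraicComplexity.DeterminantalComplexityProofs
import Literature.Computability.AlgebraicComplexity.OrbitClosure
import Literature.Computability.AlgebraicComplexity.OrbitClosureProofs
import HarnessLib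

/-!
# The pencil-coefficient family `D_m(n)` and `SL`-invariance on forms

Topic `Computability/AlgebraicComplexity` (geometric complexity theory, same-space models of
determinantal complexity).

For a commutative ring `k`, variables `σ`, a degree `d` and a size `m`, the *pencil-coefficient
family* `pencilCoeffFamily σ k d m` is the set of degree-`d` homogeneous components
`hc_d (det A)` of determinants of `m × m` matrices `A` whose entries are polynomials of total
degree `≤ 1` (affine linear forms). Writing `A = A₀ + A₁(x)` (constant part plus linear part),
`hc_d (det (A₀ + A₁(x)))` is the coefficient of `ℓ ^ (m - d)` in the matrix-pencil determinant
`det (ℓ A₀ + A₁(x))`, whence the name. The case used in geometric complexity theory is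
`σ = Fin n × Fin n`, `k = ℂ`, `d = n`: the family `pencilFamily n m = D_m(n) ⊆ Sym^n ℂ^(n²)` of
degree-`n` forms in the `n²` variables `x_ij`. It contains every degree-`d` form of determinantal
complexity `≤ m` (`mem_pencilCoeffFamily_of_hasDetRepr`,
`mem_pencilCoeffFamily_of_determinantalComplexity_le`), is increasing in `m`
(`pencilCoeffFamily_mono`) and is stable under *all* linear substitutions of the variables
(`linSubst_mem_pencilCoeffFamily`), in particular under `GL` and `SL`; for `m = d = n` it contains
the endomorphism orbit `End(k^(n²)) · det_n` (`endOrbit_detPoly_subset_pencilCoeffFamily`).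

The companion predicate `IsSLInvariantOnForms d F` says that a polynomial `F` in the coefficients
(coordinates indexed by all monomials `σ →₀ ℕ`, as for `coeffVec`, file `OrbitClosure.lean`) takes
the same value at `f` and at `g · f` for every `g ∈ SL σ k` (acting by `linSubst`) and every form
`f` of degree `d`, i.e. `F` restricted to `Sym^d` is an `SL`-invariant function. These `F` form a
`k`-subalgebra (`slInvariantsOnForms`).

## Sources

* J. M. Landsberg, *Geometry and complexity theory*, CUP 2017 (key `Landsberg2017`): §1.2.5
  (`End(ℂ^(n²))` acting on `S^n ℂ^(n²)` by `L · p(x) = p(Lᵀ x)`, the set `End(ℂ^(n²)) · det_n`,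
  eq. (1.2.4)), Def. 1.2.4.1 (`dc`), §6.1.6 ("if `perm(y) = det_n (Λ + ∑ A_ij y_ij)` then
  `ℓ^(n-m) perm_m = det_n (ℓ Λ + ∑ A_ij y_ij)`"; "`\overline{GL_(n²) · [det_n]} =
  \overline{End(ℂ^(n²)) · [det_n]}`").
* P. Bürgisser, C. Ikenmeyer, *Fundamental invariants of orbit closures*, J. Algebra 477 (2017)
  = arXiv:1511.02927 (key `BurgisserIkenmeyer2017`), §2 (`Sym^D ℂ^m` with the natural action of
  `GL_m`, polystability), §3 (the rings of `SL_m`-invariants `O(Sym^D ℂ^m)^{SL_m}`, `O(\overline{Gw})^{SL_m}`).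
* K. Mulmuley, M. Sohoni, *Geometric complexity theory I*, SIAM J. Comput. 31 (2001), §4
  (forms as points of `V = Sym^d`, orbit closures; key `MulmuleySohoni2001`).
* T. Mignon, N. Ressayre, *A quadratic bound for the determinant and permanent problem*, IMRN
  2004, §1 (affine determinantal representations; key `MignonRessayre2004`).

## Design

* `pencilCoeffFamily σ k d m` is stated for any commutative ring and any variable type, with the
  set-builder body written *literally* as
  `{g | ∃ A : Matrix (Fin m) (Fin m) (MvPolynomial σ k), (∀ i j, (A i j).totalDegree ≤ 1) ∧
  homogeneousComponent d A.det = g}` — the first conjunct is the one of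
  `HasDetRepr`/`IsAffineDetRepr` — so that the specialisation `pencilFamily n m` agrees with the
  sets inlined in route statements by `rfl` (`pencilFamily_def`), and a hypothesis quantified over
  the family can be traded for one quantified over affine matrices (`forall_mem_pencilCoeffFamily_iff`).
* `pencilFamily n m` is an `abbrev` for `pencilCoeffFamily (Fin n × Fin n) ℂ n m`.
* `IsSLInvariantOnForms d F` takes `σ`, `k` implicitly (read off from
  `F : MvPolynomial (σ →₀ ℕ) k`); `k` is a field because `coeffVec` is. Invariance is demanded only
  at forms of degree `d` (coordinates of other degrees do not matter there); the group element acts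
  through the coercion `(g : Matrix σ σ k)` and `linSubst`, as in `glOrbit`/`linSubstRep`.
* Junk: for `m = 0` the determinant of the empty matrix is `1`, so `pencilCoeffFamily σ k 0 0 = {1}`
  and `pencilCoeffFamily σ k d 0 = {0}` for `d ≥ 1`; for `d > m` the family is `{0}` (`det A` has
  total degree `≤ m`, `totalDegree_le_of_hasDetRepr_holds`). No statement below uses these cases.
* Not here: the identification of the Zariski closure of `D_n(n)` with the orbit closure of
  `det_n` (it needs the inclusion `D_n(n) ⊆ End · det_n`, i.e. `hc_n det (A₀ + A₁(x)) = det A₁(x)`),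
  and every separation / non-membership statement (those are problem-side items).
-/

noncomputable section

open MvPolynomial

namespace Literature.Computability.AlgebraicComplexity

/-! ### The pencil-coefficient family over a commutative ring -/

section General

variable (σ : Type*) (k : Type*) [CommRing k]

/-- The *pencil-coefficient family* `D_m^d`: the set of degree-`d` homogeneous components
`hc_d (det A)` of determinants of `m × m` matrices `A` of affine linear forms (entries of total
degree `≤ 1`) in the variables `σ` over `k`. With `A = A₀ + A₁(x)`, `hc_d det (A₀ + A₁(x))` is the
coefficient of `ℓ^(m-d)` in the pencil determinant `det (ℓ A₀ + A₁(x))` (Landsberg 2017 §6.1.6: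
`per_m = det_n (Λ + ∑ A_ij y_ij)` gives `ℓ^(n-m) per_m = det_n (ℓ Λ + ∑ A_ij y_ij)`). It contains
every degree-`d` form of determinantal complexity `≤ m` (affine determinantal representations:
Mignon–Ressayre 2004 §1, Landsberg 2017 Def. 1.2.4.1; forms as points of `Sym^d` acted on by linear
substitution: Mulmuley–Sohoni 2001 §4). The name and the letter `D_m(n)` are ours (a convenience
set requested by problem-side statements, which inline its body). [cite: Landsberg2017, §6.1.6] -/
def pencilCoeffFamily (d m : ℕ) : Set (MvPolynomial σ k) :=
  {g | ∃ A : Matrix (Fin m) (Fin m) (MvPolynomial σ k),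
    (∀ i j, (A i j).totalDegree ≤ 1) ∧ homogeneousComponent d A.det = g}

variable {σ k}

/-- Membership in the pencil-coefficient family, unfolded (Mignon–Ressayre 2004 §1). [cite: MignonRessayre2004, §1] -/
theorem mem_pencilCoeffFamily_iff {d m : ℕ} {g : MvPolynomial σ k} :
    g ∈ pencilCoeffFamily σ k d m ↔ ∃ A : Matrix (Fin m) (Fin m) (MvPolynomial σ k),
      (∀ i j, (A i j).totalDegree ≤ 1) ∧ homogeneousComponent d A.det = g :=
  Iff.rfl

/-- The defining elements: `hc_d (det A) ∈ D_m^d` for every `m × m` matrix `A` of affine linear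
forms (Mignon–Ressayre 2004 §1). [cite: MignonRessayre2004, §1] -/
theorem homogeneousComponent_det_mem_pencilCoeffFamily {m : ℕ} (d : ℕ)
    (A : Matrix (Fin m) (Fin m) (MvPolynomial σ k)) (hA : ∀ i j, (A i j).totalDegree ≤ 1) :
    homogeneousComponent d A.det ∈ pencilCoeffFamily σ k d m :=
  ⟨A, hA, rfl⟩

/-- A property holds on all of `D_m^d` iff it holds at `hc_d (det A)` for every `m × m` matrix `A`
of affine linear forms — the form in which "`F` vanishes on `D_m(n)`" is usually written
(Mignon–Ressayre 2004 §1; Bürgisser–Ikenmeyer 2017 §3). [cite: MignonRessayre2004, §1] -/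
theorem forall_mem_pencilCoeffFamily_iff {d m : ℕ} {P : MvPolynomial σ k → Prop} :
    (∀ g ∈ pencilCoeffFamily σ k d m, P g) ↔
      ∀ A : Matrix (Fin m) (Fin m) (MvPolynomial σ k), (∀ i j, (A i j).totalDegree ≤ 1) →
        P (homogeneousComponent d A.det) :=
  ⟨fun h A hA => h _ ⟨A, hA, rfl⟩, fun h _ ⟨A, hA, hg⟩ => hg ▸ h A hA⟩

/-- Every element of `D_m^d` is a form of degree `d` (Mulmuley–Sohoni 2001 §4: the family lives in
`Sym^d`). [cite: MulmuleySohoni2001, §4] -/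
theorem isHomogeneous_of_mem_pencilCoeffFamily {d m : ℕ} {g : MvPolynomial σ k}
    (hg : g ∈ pencilCoeffFamily σ k d m) : g.IsHomogeneous d := by
  obtain ⟨A, -, rfl⟩ := hg
  exact homogeneousComponent_isHomogeneous d _

/-- The pencil-coefficient family is contained in the space of degree-`d` forms
(Mulmuley–Sohoni 2001 §4). [cite: MulmuleySohoni2001, §4] -/
theorem pencilCoeffFamily_subset_homogeneousSubmodule (d m : ℕ) :
    pencilCoeffFamily σ k d m ⊆ homogeneousSubmodule σ k d :=
  fun _ hg => (mem_homogeneousSubmodule d _).mpr (isHomogeneous_of_mem_pencilCoeffFamily hg)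

/-- A degree-`d` form with an affine determinantal representation of size `m` lies in `D_m^d`:
`f = det A` gives `hc_d (det A) = hc_d f = f`. This is `{dc ≤ m} ∩ Sym^d ⊆ D_m^d`
(Mignon–Ressayre 2004 §1). [cite: MignonRessayre2004, §1] -/
theorem mem_pencilCoeffFamily_of_hasDetRepr {f : MvPolynomial σ k} {d m : ℕ}
    (h : HasDetRepr f m) (hf : f.IsHomogeneous d) : f ∈ pencilCoeffFamily σ k d m := by
  obtain ⟨A, hA, hdet⟩ := h
  exact ⟨A, hA, by rw [hdet, homogeneousComponent_eq_self hf]⟩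

/-- A degree-`d` form `f` with `dc f ≤ m` lies in `D_m^d` (Mignon–Ressayre 2004 §1). Uses that the
infimum defining `dc f` is attained (`hasDetRepr_determinantalComplexity_holds`, resting on
Valiant's universality of the determinant) and padding (`HasDetRepr.mono_holds`). [cite: MignonRessayre2004, §1] -/
theorem mem_pencilCoeffFamily_of_determinantalComplexity_le {f : MvPolynomial σ k} {d m : ℕ}
    (h : determinantalComplexity f ≤ m) (hf : f.IsHomogeneous d) :
    f ∈ pencilCoeffFamily σ k d m :=
  mem_pencilCoeffFamily_of_hasDetRepr
    (HasDetRepr.mono_holds (hasDetRepr_determinantalComplexity_holds f) h) hf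

/-- Monotonicity in the size: `D_m^d ⊆ D_{m'}^d` for `m ≤ m'`, by padding the affine matrix with an
identity block (`HasDetRepr.mono_holds`; Mignon–Ressayre 2004 §1). [cite: MignonRessayre2004, §1] -/
theorem pencilCoeffFamily_mono (d : ℕ) {m m' : ℕ} (h : m ≤ m') :
    pencilCoeffFamily σ k d m ⊆ pencilCoeffFamily σ k d m' := by
  rintro g ⟨A, hA, rfl⟩
  obtain ⟨A', hA', hdet⟩ := HasDetRepr.mono_holds (f := A.det) ⟨A, hA, rfl⟩ h
  exact ⟨A', hA', by rw [hdet]⟩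

/-- `D_m^d ⊆ D_{m+1}^d` (Mignon–Ressayre 2004 §1). [cite: MignonRessayre2004, §1] -/
theorem pencilCoeffFamily_subset_succ (d m : ℕ) :
    pencilCoeffFamily σ k d m ⊆ pencilCoeffFamily σ k d (m + 1) :=
  pencilCoeffFamily_mono d (Nat.le_succ m)

/-- `0 ∈ D_m^d` for `m ≥ 1`: take the zero matrix (Mignon–Ressayre 2004 §1). [cite: MignonRessayre2004, §1] -/
theorem zero_mem_pencilCoeffFamily (d : ℕ) {m : ℕ} (hm : 0 < m) :
    (0 : MvPolynomial σ k) ∈ pencilCoeffFamily σ k d m := by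
  haveI : Nonempty (Fin m) := ⟨⟨0, hm⟩⟩
  exact ⟨0, fun i j => by simp, by rw [Matrix.det_zero, map_zero]⟩

variable [Fintype σ]

/-- A linear substitution of variables commutes with taking homogeneous components: it maps forms
of degree `i` to forms of degree `i` (`linSubst_isHomogeneous`), so it respects the decomposition
`p = ∑ hc_i p`. Landsberg 2017 §1.2 (the action of `End(ℂ^N)` preserves each `Sym^d`). [cite: Landsberg2017, §1.2] -/
theorem homogeneousComponent_linSubst (B : Matrix σ σ k) (d : ℕ) (p : MvPolynomial σ k) :
    homogeneousComponent d (linSubst σ k B p) = linSubst σ k B (homogeneousComponent d p) := by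
  conv_lhs => rw [← sum_homogeneousComponent p, map_sum, map_sum]
  rw [Finset.sum_eq_single d]
  · exact homogeneousComponent_eq_self
      (linSubst_isHomogeneous B (homogeneousComponent_isHomogeneous d p))
  · intro i _ hid
    rw [homogeneousComponent_of_mem
      (linSubst_mem_homogeneousSubmodule B (homogeneousComponent_mem i p)), if_neg (Ne.symm hid)]
  · intro hd
    have hlt : p.totalDegree < d := by
      rw [Finset.mem_range] at hd
      omega
    rw [homogeneousComponent_eq_zero d p hlt, map_zero, map_zero]

/-- Linear substitution preserves affine determinantal representations of each size: apply the
substitution entrywise (it does not raise total degrees, `totalDegree_linSubst_le_holds`, and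
commutes with `det`, `AlgHom.map_det`). Landsberg 2017 §1.2; Mignon–Ressayre 2004 §1. [cite: MignonRessayre2004, §1] -/
theorem hasDetRepr_linSubst (B : Matrix σ σ k) {f : MvPolynomial σ k} {m : ℕ}
    (h : HasDetRepr f m) : HasDetRepr (linSubst σ k B f) m := by
  obtain ⟨A, hA, rfl⟩ := h
  refine ⟨(linSubst σ k B).mapMatrix A, fun i j => ?_, ((linSubst σ k B).map_det A).symm⟩
  rw [AlgHom.mapMatrix_apply, Matrix.map_apply]
  exact (totalDegree_linSubst_le_holds B (A i j)).trans (hA i j)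

/-- **Stability under all linear substitutions.** `D_m^d` is stable under `f ↦ f ∘ Bᵀ` for every
square matrix `B` (invertible or not): substituting in the entries of `A` keeps them affine, and
`linSubst B` commutes with `det` and with `hc_d`. In particular `D_m(n)` is a `GL_(n²)`- and
`SL_(n²)`-stable subset of `Sym^n` (Mulmuley–Sohoni 2001 §4; Landsberg 2017 §1.2). [cite: MulmuleySohoni2001, §4] -/
theorem linSubst_mem_pencilCoeffFamily (B : Matrix σ σ k) {d m : ℕ} {g : MvPolynomial σ k}
    (hg : g ∈ pencilCoeffFamily σ k d m) : linSubst σ k B g ∈ pencilCoeffFamily σ k d m := by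
  obtain ⟨A, hA, rfl⟩ := hg
  obtain ⟨A', hA', hdet⟩ := hasDetRepr_linSubst B (f := A.det) ⟨A, hA, rfl⟩
  exact ⟨A', hA', by rw [hdet, homogeneousComponent_linSubst]⟩

/-- The image of `D_m^d` under any linear substitution is contained in `D_m^d`
(Mulmuley–Sohoni 2001 §4). [cite: MulmuleySohoni2001, §4] -/
theorem image_linSubst_pencilCoeffFamily_subset (B : Matrix σ σ k) (d m : ℕ) :
    linSubst σ k B '' pencilCoeffFamily σ k d m ⊆ pencilCoeffFamily σ k d m := by
  rintro _ ⟨g, hg, rfl⟩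
  exact linSubst_mem_pencilCoeffFamily B hg

variable [DecidableEq σ]

/-- `GL`-stability: the orbit of any element of `D_m^d` stays in `D_m^d`
(Mulmuley–Sohoni 2001 §4). [cite: MulmuleySohoni2001, §4] -/
theorem glOrbit_subset_pencilCoeffFamily {d m : ℕ} {g : MvPolynomial σ k}
    (hg : g ∈ pencilCoeffFamily σ k d m) : glOrbit σ k g ⊆ pencilCoeffFamily σ k d m := by
  rintro _ ⟨G, rfl⟩
  exact linSubst_mem_pencilCoeffFamily (G : Matrix σ σ k) hg

/-- The endomorphism orbit `End · det_n = {det A₁(x) : A₁ an n × n matrix of linear forms in the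
n² variables}` lies in `D_n(n)`: `B · det_n = det (B · X)` is a degree-`n` form with an affine
(indeed linear) determinantal representation of size `n` (Mulmuley–Sohoni 2001 §4;
Mignon–Ressayre 2004 §1). [cite: MulmuleySohoni2001, §4] -/
theorem endOrbit_detPoly_subset_pencilCoeffFamily (n : ℕ) :
    endOrbit (Fin n × Fin n) k (detPoly (Fin n) k) ⊆ pencilCoeffFamily (Fin n × Fin n) k n n := by
  rintro _ ⟨B, rfl⟩
  refine mem_pencilCoeffFamily_of_hasDetRepr (hasDetRepr_linSubst B (hasDetRepr_detPoly n)) ?_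
  simpa using linSubst_isHomogeneous B (detPoly_isHomogeneous (n := Fin n) (k := k))

/-- `GL · det_n ⊆ D_n(n)` (Mulmuley–Sohoni 2001 §4). [cite: MulmuleySohoni2001, §4] -/
theorem glOrbit_detPoly_subset_pencilCoeffFamily (n : ℕ) :
    glOrbit (Fin n × Fin n) k (detPoly (Fin n) k) ⊆ pencilCoeffFamily (Fin n × Fin n) k n n :=
  (glOrbit_subset_endOrbit _).trans (endOrbit_detPoly_subset_pencilCoeffFamily n)

end General

/-! ### `SL`-invariant polynomials on forms of degree `d` -/

section Invariants

variable {σ : Type*} {k : Type*} [Fintype σ] [DecidableEq σ] [Field k]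

/-- `IsSLInvariantOnForms d F`: the polynomial `F` in the coefficients (one coordinate `X_e` per
monomial `e : σ →₀ ℕ`, evaluated at `coeffVec f`) is invariant under the special linear group on
forms of degree `d`: `F (g · f) = F f` for every `g ∈ SL σ k`, acting by the linear substitution
`linSubst ↑g`, and every `f` homogeneous of degree `d`. Equivalently, the restriction of `F` to
`Sym^d (k^σ)` lies in the invariant ring `O(Sym^d k^σ)^{SL}` of Bürgisser–Ikenmeyer 2017 §3
(`Sym^D ℂ^m` "with the natural action of `GL_m`", §2; since `SL` is a group stable under inverse
and transpose, the predicate does not depend on the convention `f ↦ f ∘ gᵀ` vs `f ↦ f ∘ g⁻¹`).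
[cite: BurgisserIkenmeyer2017, §3] -/
def IsSLInvariantOnForms (d : ℕ) (F : MvPolynomial (σ →₀ ℕ) k) : Prop :=
  ∀ (g : Matrix.SpecialLinearGroup σ k) (f : MvPolynomial σ k), f.IsHomogeneous d →
    aeval (coeffVec (linSubst σ k (g : Matrix σ σ k) f)) F = aeval (coeffVec f) F

/-- Unfolding lemma for `IsSLInvariantOnForms` (Bürgisser–Ikenmeyer 2017 §3). [cite: BurgisserIkenmeyer2017, §3] -/
theorem isSLInvariantOnForms_iff {d : ℕ} {F : MvPolynomial (σ →₀ ℕ) k} :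
    IsSLInvariantOnForms d F ↔
      ∀ (g : Matrix.SpecialLinearGroup σ k) (f : MvPolynomial σ k), f.IsHomogeneous d →
        aeval (coeffVec (linSubst σ k (g : Matrix σ σ k) f)) F = aeval (coeffVec f) F :=
  Iff.rfl

/-- Constants are invariant (Bürgisser–Ikenmeyer 2017 §3, degree `0`). [cite: BurgisserIkenmeyer2017, §3] -/
theorem isSLInvariantOnForms_C (d : ℕ) (c : k) :
    IsSLInvariantOnForms (σ := σ) d (C c) := by
  intro g f _
  simp only [algHom_C]

variable (σ k)

/-- The `SL`-invariant polynomials on forms of degree `d` form a `k`-subalgebra of the coordinate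
ring `k[X_e : e : σ →₀ ℕ]` (evaluation at a point is a `k`-algebra homomorphism) — the ring of
`SL`-invariants `O(Sym^D ℂ^m)^{SL_m}` of Bürgisser–Ikenmeyer 2017 §3, pulled back to all
coordinates. [cite: BurgisserIkenmeyer2017, §3] -/
def slInvariantsOnForms (d : ℕ) : Subalgebra k (MvPolynomial (σ →₀ ℕ) k) where
  carrier := {F | IsSLInvariantOnForms d F}
  mul_mem' {F G} hF hG := fun g f hf => by simp only [map_mul, hF g f hf, hG g f hf]
  add_mem' {F G} hF hG := fun g f hf => by simp only [map_add, hF g f hf, hG g f hf]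
  algebraMap_mem' c := fun g f _ => by simp only [AlgHom.commutes]

variable {σ k}

/-- Membership in `slInvariantsOnForms` is `IsSLInvariantOnForms` (Bürgisser–Ikenmeyer 2017 §3). [cite: BurgisserIkenmeyer2017, §3] -/
@[simp]
theorem mem_slInvariantsOnForms_iff {d : ℕ} {F : MvPolynomial (σ →₀ ℕ) k} :
    F ∈ slInvariantsOnForms σ k d ↔ IsSLInvariantOnForms d F :=
  Iff.rfl

/-- An `SL`-invariant on forms of degree `d` is constant along the `SL`-orbit of an element of the
pencil-coefficient family `D_m^d` (which consists of forms of degree `d` and is `SL`-stable).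
Bürgisser–Ikenmeyer 2017 §3. [cite: BurgisserIkenmeyer2017, §3] -/
theorem IsSLInvariantOnForms.apply_linSubst_of_mem_pencilCoeffFamily {d m : ℕ}
    {F : MvPolynomial (σ →₀ ℕ) k} (hF : IsSLInvariantOnForms d F)
    (g : Matrix.SpecialLinearGroup σ k) {f : MvPolynomial σ k}
    (hf : f ∈ pencilCoeffFamily σ k d m) :
    aeval (coeffVec (linSubst σ k (g : Matrix σ σ k) f)) F = aeval (coeffVec f) F :=
  hF g f (isHomogeneous_of_mem_pencilCoeffFamily hf)

end Invariants


/-! ### The top homogeneous component of an affine determinant -/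

section TopDegree

variable {σ : Type*} {k : Type*} [CommRing k]

/-- An affine polynomial (total degree `≤ 1`) is the sum of its constant part and its linear part.
[folklore] -/
theorem eq_homogeneousComponent_zero_add_one {p : MvPolynomial σ k} (hp : p.totalDegree ≤ 1) :
    p = homogeneousComponent 0 p + homogeneousComponent 1 p := by
  ext d
  rw [coeff_add, coeff_homogeneousComponent, coeff_homogeneousComponent]
  by_cases h0 : d.degree = 0
  · have h1 : d.degree ≠ 1 := by omega
    rw [if_pos h0, if_neg h1, add_zero]
  · by_cases h1 : d.degree = 1
    · rw [if_neg h0, if_pos h1, zero_add]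
    · rw [if_neg h0, if_neg h1, add_zero]
      apply coeff_eq_zero_of_totalDegree_lt
      rw [← Finsupp.degree_apply]
      omega

/-- Multiplication by a form of degree `a` shifts homogeneous components by `a`:
`hc_{a+j} (ℓ q) = ℓ · hc_j q`. [folklore] -/
theorem homogeneousComponent_mul_of_isHomogeneous {ℓ : MvPolynomial σ k} {a : ℕ}
    (hℓ : ℓ.IsHomogeneous a) (q : MvPolynomial σ k) (j : ℕ) :
    homogeneousComponent (a + j) (ℓ * q) = ℓ * homogeneousComponent j q := by
  conv_lhs => rw [← sum_homogeneousComponent q, Finset.mul_sum, map_sum]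
  rw [Finset.sum_eq_single j]
  · exact homogeneousComponent_eq_self (hℓ.mul (homogeneousComponent_isHomogeneous j q))
  · intro i _ hij
    rw [homogeneousComponent_of_mem (hℓ.mul (homogeneousComponent_isHomogeneous i q)), if_neg]
    omega
  · intro hj
    have hlt : q.totalDegree < j := by
      rw [Finset.mem_range] at hj
      omega
    rw [homogeneousComponent_eq_zero j q hlt, mul_zero, map_zero]

/-- The top homogeneous component of a product of `|s|` affine polynomials is the product of their
linear parts: `hc_{|s|} (∏ (c_i + ℓ_i)) = ∏ ℓ_i`. [folklore] -/
theorem homogeneousComponent_card_prod_of_totalDegree_le_one {ι : Type*} (s : Finset ι)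
    (p : ι → MvPolynomial σ k) (hp : ∀ i ∈ s, (p i).totalDegree ≤ 1) :
    homogeneousComponent s.card (∏ i ∈ s, p i) = ∏ i ∈ s, homogeneousComponent 1 (p i) := by
  classical
  induction s using Finset.induction_on with
  | empty => simp
  | insert a s ha ih =>
    rw [Finset.prod_insert ha, Finset.prod_insert ha, Finset.card_insert_of_notMem ha]
    have hpa := hp a (Finset.mem_insert_self a s)
    have hs : ∀ i ∈ s, (p i).totalDegree ≤ 1 := fun i hi => hp i (Finset.mem_insert_of_mem hi)
    have hlt : (∏ i ∈ s, p i).totalDegree < s.card + 1 :=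
      calc (∏ i ∈ s, p i).totalDegree ≤ ∑ i ∈ s, (p i).totalDegree := totalDegree_finsetProd _ _
        _ ≤ ∑ _i ∈ s, 1 := Finset.sum_le_sum hs
        _ < s.card + 1 := by simp
    conv_lhs => rw [eq_homogeneousComponent_zero_add_one hpa]
    rw [add_mul, map_add, homogeneousComponent_zero, homogeneousComponent_C_mul,
      homogeneousComponent_eq_zero (s.card + 1) _ hlt, mul_zero, zero_add, add_comm s.card 1,
      homogeneousComponent_mul_of_isHomogeneous (homogeneousComponent_isHomogeneous 1 (p a)),
      ih hs]

/-- **Top degree of an affine determinant.** For a square matrix `A = A₀ + A₁(x)` of affine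
linear forms, the top homogeneous component of `det A` is the determinant of the linear part:
`hc_{|ι|} det (A₀ + A₁(x)) = det A₁(x)` — the coefficient of `ℓ⁰` in `det (ℓ A₀ + A₁(x))`
(Landsberg 2017 §6.1.6, `det_n (ℓ Λ + ∑ A_ij y_ij)`; expand `det` as a signed sum of products of
`|ι|` affine entries). [cite: Landsberg2017, §6.1.6] -/
theorem homogeneousComponent_card_det_of_totalDegree_le_one {ι : Type*} [Fintype ι]
    [DecidableEq ι] (A : Matrix ι ι (MvPolynomial σ k)) (hA : ∀ i j, (A i j).totalDegree ≤ 1) :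
    homogeneousComponent (Fintype.card ι) A.det = (A.map (homogeneousComponent 1)).det := by
  rw [Matrix.det_apply, Matrix.det_apply, map_sum]
  refine Finset.sum_congr rfl fun π _ => ?_
  rw [Units.smul_def, Units.smul_def, map_zsmul]
  congr 1
  simpa only [Matrix.map_apply, Finset.card_univ] using
    homogeneousComponent_card_prod_of_totalDegree_le_one (Finset.univ : Finset ι)
      (fun i => A (π i) i) fun i _ => hA (π i) i

end TopDegree

/-! ### `D_n(n) = End · det_n` and its Zariski closure -/

section EndOrbit

variable {k : Type*} [CommRing k]

/-- `D_n(n) ⊆ End · det_n`: the degree-`n` component of `det (A₀ + A₁(x))`, `A` an `n × n` affine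
matrix in the `n²` variables, is `det A₁(x)` (`homogeneousComponent_card_det_of_totalDegree_le_one`),
and a matrix of linear forms `A₁(x)` is the image `B · X` of the generic matrix under the linear
substitution `B` whose column `(i, j)` lists the coefficients of `A₁(x)_{ij}`, so that
`det A₁(x) = B · det_n` (Landsberg 2017 §1.2.5, `End(ℂ^(n²)) · det_n`, and §6.1.6: "setting each
entry of the `n × n` matrix to a linear combination of the variables ... is precisely what the
elements of `End(ℂ^(n²))` can accomplish"). [cite: Landsberg2017, §6.1.6] -/
theorem pencilCoeffFamily_subset_endOrbit_detPoly (n : ℕ) :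
    pencilCoeffFamily (Fin n × Fin n) k n n ⊆ endOrbit (Fin n × Fin n) k (detPoly (Fin n) k) := by
  rintro _ ⟨A, hA, rfl⟩
  -- the linear part of each entry is a `k`-combination of the variables
  have hlin : ∀ i j : Fin n, ∃ c : Fin n × Fin n → k,
      ∑ v, c v • (X v : MvPolynomial (Fin n × Fin n) k) = homogeneousComponent 1 (A i j) := by
    intro i j
    apply (Submodule.mem_span_range_iff_exists_fun (R := k)).mp
    rw [← homogeneousSubmodule_one_eq_span_X]
    exact homogeneousComponent_mem 1 (A i j)
  choose c hc using hlin
  refine ⟨Matrix.of fun v ij => c ij.1 ij.2 v, ?_⟩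
  have htop := homogeneousComponent_card_det_of_totalDegree_le_one A hA
  rw [Fintype.card_fin] at htop
  show linSubst _ k _ (detPoly (Fin n) k) = _
  rw [htop, detPoly, AlgHom.map_det, AlgHom.mapMatrix_apply]
  congr 1
  ext i j : 2
  rw [Matrix.map_apply, Matrix.map_apply, Matrix.mvPolynomialX_apply, linSubst_X, ← hc i j]
  simp only [Matrix.of_apply]

/-- **`D_n(n) = End(k^(n²)) · det_n`**: the degree-`n` pencil coefficients of size `n` are exactly
the determinants of `n × n` matrices of linear forms in the `n²` variables, i.e. the endomorphism
orbit of `det_n` (Landsberg 2017 §1.2.5, eq. (1.2.4), and §6.1.6). [cite: Landsberg2017, §6.1.6] -/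
theorem pencilCoeffFamily_eq_endOrbit_detPoly (n : ℕ) :
    pencilCoeffFamily (Fin n × Fin n) k n n = endOrbit (Fin n × Fin n) k (detPoly (Fin n) k) :=
  Set.Subset.antisymm (pencilCoeffFamily_subset_endOrbit_detPoly n)
    (endOrbit_detPoly_subset_pencilCoeffFamily n)

end EndOrbit

section Closure

variable {K : Type*} [Field K]

/-- Over an infinite field, `D_n(n) = End · det_n` lies in the orbit closure `Δ[det_n]` of the
determinant (`endOrbit_subset_orbitClosure_holds`: `GL` is Zariski dense in `End`).
Landsberg 2017 §6.1.6 (`\overline{GL_(n²) · det_n} = \overline{End(ℂ^(n²)) · det_n}`);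
Mulmuley–Sohoni 2001 §4. [cite: Landsberg2017, §6.1.6] -/
theorem pencilCoeffFamily_subset_orbitClosure_detPoly [Infinite K] (n : ℕ) :
    pencilCoeffFamily (Fin n × Fin n) K n n ⊆ orbitClosure (detPoly (Fin n) K) :=
  (pencilCoeffFamily_subset_endOrbit_detPoly n).trans
    (endOrbit_subset_orbitClosure_holds (detPoly (Fin n) K))

/-- **`closure D_n(n) = closure (GL · det_n)`**: over an infinite field the Zariski closures, in
coefficient space, of the pencil-coefficient family `D_n(n)` and of the orbit `GL_(n²) · det_n`
coincide (`GL · det_n ⊆ D_n(n) = End · det_n ⊆ Δ[det_n]`). Landsberg 2017 §6.1.6 ("Note that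
`\overline{GL_(n²) · [det_n]} = \overline{End(ℂ^(n²)) · [det_n]}`"); Mulmuley–Sohoni 2001 §4. [cite: Landsberg2017, §6.1.6] -/
theorem zariskiClosure_image_pencilCoeffFamily_eq [Infinite K] (n : ℕ) :
    zariskiClosure (coeffVec '' pencilCoeffFamily (Fin n × Fin n) K n n) =
      zariskiClosure (coeffVec '' glOrbit (Fin n × Fin n) K (detPoly (Fin n) K)) := by
  refine Set.Subset.antisymm ?_
    (zariskiClosure_mono (Set.image_mono (glOrbit_detPoly_subset_pencilCoeffFamily n)))
  rw [← zariskiClosure_zariskiClosure (coeffVec '' glOrbit (Fin n × Fin n) K (detPoly (Fin n) K))]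
  refine zariskiClosure_mono ?_
  rintro _ ⟨g, hg, rfl⟩
  exact pencilCoeffFamily_subset_orbitClosure_detPoly n hg

/-- The orbit closure of the determinant, described by the pencil-coefficient family: over an
infinite field, `g ∈ Δ[det_n]` iff `coeffVec g` lies in the Zariski closure of `coeffVec '' D_n(n)`
(Landsberg 2017 §6.1.6; Mulmuley–Sohoni 2001 §4). [cite: Landsberg2017, §6.1.6] -/
theorem orbitClosure_detPoly_eq_setOf_pencilCoeffFamily [Infinite K] (n : ℕ) :
    orbitClosure (detPoly (Fin n) K) =
      {g | coeffVec g ∈ zariskiClosure (coeffVec '' pencilCoeffFamily (Fin n × Fin n) K n n)} := by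
  ext g
  rw [orbitClosure, Set.mem_setOf_eq, Set.mem_setOf_eq, zariskiClosure_image_pencilCoeffFamily_eq]

end Closure

/-! ### The complex family `D_m(n)` of geometric complexity theory -/

section Complex

/-- The pencil-coefficient family `D_m(n) ⊆ Sym^n ℂ^(n²)` of geometric complexity theory: degree-`n`
homogeneous components of determinants of `m × m` matrices of affine linear forms in the `n²`
variables `x_ij` over `ℂ` — the coefficient of `ℓ^(m-n)` in `det (ℓ A₀ + A₁(x))`. It contains
every degree-`n` form of determinantal complexity `≤ m`, e.g. `per_n` for `m ≥ dc(per_n)`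
(Landsberg 2017 §6.1.6 for the pencil `det_n (ℓ Λ + ∑ A_ij y_ij)`, Def. 1.2.4.1 for `dc`). An
`abbrev` for `pencilCoeffFamily (Fin n × Fin n) ℂ n m`. [cite: Landsberg2017, §6.1.6] -/
abbrev pencilFamily (n m : ℕ) : Set (MvPolynomial (Fin n × Fin n) ℂ) :=
  pencilCoeffFamily (Fin n × Fin n) ℂ n m

/-- `pencilFamily n m` is, by `rfl`, the set-builder expression inlined in problem-side
statements (Landsberg 2017 §6.1.6). [cite: Landsberg2017, §6.1.6] -/
theorem pencilFamily_def (n m : ℕ) :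
    pencilFamily n m = {g : MvPolynomial (Fin n × Fin n) ℂ |
      ∃ A : Matrix (Fin m) (Fin m) (MvPolynomial (Fin n × Fin n) ℂ),
        (∀ i j, (A i j).totalDegree ≤ 1) ∧ MvPolynomial.homogeneousComponent n A.det = g} :=
  rfl

/-- `D_m(n)` is `SL_(n²)`-stable (special case of `linSubst_mem_pencilCoeffFamily`;
Mulmuley–Sohoni 2001 §4). [cite: MulmuleySohoni2001, §4] -/
theorem linSubst_specialLinearGroup_mem_pencilFamily {n m : ℕ}
    (g : Matrix.SpecialLinearGroup (Fin n × Fin n) ℂ) {f : MvPolynomial (Fin n × Fin n) ℂ}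
    (hf : f ∈ pencilFamily n m) :
    linSubst (Fin n × Fin n) ℂ (g : Matrix (Fin n × Fin n) (Fin n × Fin n) ℂ) f ∈ pencilFamily n m :=
  linSubst_mem_pencilCoeffFamily _ hf

/-- `D_m(n) ⊆ D_{m+1}(n)` (special case of `pencilCoeffFamily_mono`; Mignon–Ressayre 2004 §1). [cite: MignonRessayre2004, §1] -/
theorem pencilFamily_subset_succ (n m : ℕ) : pencilFamily n m ⊆ pencilFamily n (m + 1) :=
  pencilCoeffFamily_subset_succ n m

/-- `GL_(n²) · det_n ⊆ D_n(n)` over `ℂ` (special case of `glOrbit_detPoly_subset_pencilCoeffFamily`;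
Mulmuley–Sohoni 2001 §4). [cite: MulmuleySohoni2001, §4] -/
theorem glOrbit_detPoly_subset_pencilFamily (n : ℕ) :
    glOrbit (Fin n × Fin n) ℂ (detPoly (Fin n) ℂ) ⊆ pencilFamily n n :=
  glOrbit_detPoly_subset_pencilCoeffFamily n

/-- `D_n(n) = End(ℂ^(n²)) · det_n` over `ℂ` (special case of `pencilCoeffFamily_eq_endOrbit_detPoly`;
Landsberg 2017 §1.2.5, eq. (1.2.4), §6.1.6). [cite: Landsberg2017, §6.1.6] -/
theorem pencilFamily_self_eq_endOrbit_detPoly (n : ℕ) :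
    pencilFamily n n = endOrbit (Fin n × Fin n) ℂ (detPoly (Fin n) ℂ) :=
  pencilCoeffFamily_eq_endOrbit_detPoly n

/-- `closure D_n(n) = \overline{GL_(n²) · det_n}` over `ℂ`, as subsets of coefficient space (special
case of `zariskiClosure_image_pencilCoeffFamily_eq`; Landsberg 2017 §6.1.6). [cite: Landsberg2017, §6.1.6] -/
theorem zariskiClosure_image_pencilFamily_self (n : ℕ) :
    zariskiClosure (coeffVec '' pencilFamily n n) =
      zariskiClosure (coeffVec '' glOrbit (Fin n × Fin n) ℂ (detPoly (Fin n) ℂ)) :=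
  zariskiClosure_image_pencilCoeffFamily_eq n

/-- `Δ[det_n] = {g | coeffVec g ∈ closure (coeffVec '' D_n(n))}` over `ℂ` (special case of
`orbitClosure_detPoly_eq_setOf_pencilCoeffFamily`; Landsberg 2017 §6.1.6). [cite: Landsberg2017, §6.1.6] -/
theorem orbitClosure_detPoly_eq_setOf_pencilFamily (n : ℕ) :
    orbitClosure (detPoly (Fin n) ℂ) =
      {g | coeffVec g ∈ zariskiClosure (coeffVec '' pencilFamily n n)} :=
  orbitClosure_detPoly_eq_setOf_pencilCoeffFamily n

end Complex

end Literature.Computability.AlgebraicComplexity
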